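/-
Copyright: rh-split cell (nb, neg) gen 16 (carved by gen 17), 2026-08-27.  Splitting search over kernel-typed
RH-equivalences.  A splitting `A ∧ B ⟹ RH` is CONDITIONAL bookkeeping unless `A` and `B` are both
proved; nothing here bears on the truth of RH.
-/
import Summits.RiemannHypothesis.RiemannHypothesis.Theorems.Splittings.NbWindowsA
import HarnessLib

/-!
# Height windows of the Nyman–Beurling criterion (nb/neg V41) — part B

Continuation of `NbWindowsA` (same namespace `…Splittings.NbWindows`; the module docstring of
`NbWindowsA` states the objects, the census row and the theorem map for all parts).  Content below is the
original one-file kernel VERBATIM (lines 340–610 of the uncarved file).  No `sorry`, no new axioms, no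
definitions, no instances, no notation.
-/

noncomputable section

set_option linter.dupNamespace false
open Complex MeasureTheory Set Filter Topology
open scoped Real ENNReal Polynomial

namespace Summit.RiemannHypothesis.RiemannHypothesis.Theorems.Splittings.NbWindows

open Summit.RiemannHypothesis.RiemannHypothesis.Theses.NymanBeurling
open Summit.RiemannHypothesis.RiemannHypothesis.Theorems
open Literature.NumberTheory.LFunctions.BaezDuarteOnlyIf

/-! ## §W.2c — from a polynomial in `b^{-it}` to a Dirichlet polynomial supported on powers of `b` -/

/-- `m^{1/2} · m^{-(1/2+it)} = m^{-it} = e^{-i t log m}` for a natural number `m ≥ 1`. [folklore] -/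
theorem cpow_half_mul_cpow_neg (m : ℕ) (hm : 0 < m) (t : ℝ) :
    (m : ℂ) ^ (2⁻¹ : ℂ) * (m : ℂ) ^ (-(1 / 2 + t * I)) =
      Complex.exp (((-(Real.log m * t) : ℝ) : ℂ) * I) := by
  have hm0 : (m : ℂ) ≠ 0 := Nat.cast_ne_zero.2 hm.ne'
  rw [← Complex.cpow_add _ _ hm0, Complex.cpow_def_of_ne_zero hm0, ← Complex.natCast_log]
  congr 1
  push_cast
  ring

/-- `(b^j)^{1/2} · (b^j)^{-(1/2+it)} = (b^{-it})^j`. [folklore] -/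
theorem cpow_half_mul_cpow_neg_pow (b j : ℕ) (hb : 0 < b) (t : ℝ) :
    ((b ^ j : ℕ) : ℂ) ^ (2⁻¹ : ℂ) * ((b ^ j : ℕ) : ℂ) ^ (-(1 / 2 + t * I)) =
      Complex.exp (((-(Real.log b * t) : ℝ) : ℂ) * I) ^ j := by
  rw [cpow_half_mul_cpow_neg (b ^ j) (pow_pos hb j) t, ← Complex.exp_nat_mul]
  congr 1
  rw [Nat.cast_pow, Real.log_pow]
  push_cast
  ring

/-- WINDOWED DISTANCE ALONG POWERS OF `b` (general continuous `G` with null zero set).  If `b ≥ 2`,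
`0 ≤ T` and `T·log b < π/2`, then for every `ε > 0` some Dirichlet polynomial `Σ a_n (n+1)^{-s}`
supported on `{n : n+1 = b^j}` has `∫⁻_{[-T,T]} |1 - G(t)·Σ a_n (n+1)^{-(1/2+it)}|²/(1/4+t²) < ε`:
combine `window_tikhonov` with `exists_polynomial_near` and `a_{b^j-1} = c_j (b^j)^{1/2}`. [folklore] -/
theorem window_dirichlet {G : ℝ → ℂ} (hG : Continuous G) (hG0 : ∀ᵐ t : ℝ, G t ≠ 0)
    {b : ℕ} (hb : 2 ≤ b) {T : ℝ} (hT : 0 ≤ T) (hbT : T * Real.log b < π / 2) {ε : ℝ} (hε : 0 < ε) :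
    ∃ (N : ℕ) (a : Fin N → ℂ), (∀ n : Fin N, a n ≠ 0 → ∃ j : ℕ, (n : ℕ) + 1 = b ^ j) ∧
      ∫⁻ t in Set.Icc (-T) T, ENNReal.ofReal (‖1 - G t *
        ∑ n : Fin N, a n * ((n : ℂ) + 1) ^ (-(1 / 2 + t * I))‖ ^ 2 / (1 / 4 + t ^ 2)) <
        ENNReal.ofReal ε := by
  classical
  have hb1 : (1 : ℝ) < b := by exact_mod_cast (lt_of_lt_of_le one_lt_two hb)
  have hL : 0 < Real.log b := Real.log_pos hb1
  have hb0 : 0 < b := by omega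
  obtain ⟨δ, hδ, U, hU, hmain⟩ := window_tikhonov hG hG0 T hε
  set K : Set ℝ := Set.Icc (-T) T with hKdef
  set Uc : C(K, ℂ) := ⟨fun x => U x, hU.comp continuous_subtype_val⟩ with hUc
  obtain ⟨p, hp⟩ := exists_polynomial_near hL hT (by rwa [mul_comm] at hbT) Uc hδ
  set J : ℕ := p.natDegree + 1 with hJ
  set c : ℕ → ℂ := fun j => p.coeff j * ((b ^ j : ℕ) : ℂ) ^ (2⁻¹ : ℂ) with hc
  set A : ℕ → ℂ := fun k => ∑ j ∈ Finset.range J, if k + 1 = b ^ j then c j else 0 with hA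
  refine ⟨b ^ J, fun n => A n, ?_, ?_⟩
  · intro n hn
    obtain ⟨j, -, hj⟩ := Finset.exists_ne_zero_of_sum_ne_zero hn
    refine ⟨j, ?_⟩
    by_contra h
    exact hj (if_neg h)
  · have hD : ∀ t : ℝ, (∑ n : Fin (b ^ J), A n * ((n : ℂ) + 1) ^ (-(1 / 2 + t * I))) =
        p.eval (Complex.exp (((-(Real.log b * t)) : ℝ) * I)) := by
      intro t
      have key : ∀ j ∈ Finset.range J,
          (∑ k ∈ Finset.range (b ^ J), (if k + 1 = b ^ j then c j else 0) *
            ((k : ℂ) + 1) ^ (-(1 / 2 + t * I))) = c j * ((b ^ j : ℕ) : ℂ) ^ (-(1 / 2 + t * I)) := by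
        intro j hj
        have hj' : j < J := Finset.mem_range.1 hj
        have h1 : b ^ j - 1 + 1 = b ^ j := Nat.sub_add_cancel (Nat.one_le_pow _ _ hb0)
        rw [Finset.sum_eq_single (b ^ j - 1)]
        · rw [if_pos h1, ← Nat.cast_add_one, h1]
        · intro k _ hne
          rw [if_neg (fun h => hne (Nat.eq_sub_of_add_eq h)), zero_mul]
        · intro h
          exact absurd (Finset.mem_range.2 (lt_of_lt_of_le (Nat.sub_lt (Nat.one_le_pow _ _ hb0) one_pos)
            (Nat.pow_le_pow_right hb0 hj'.le))) h
      calc (∑ n : Fin (b ^ J), A n * ((n : ℂ) + 1) ^ (-(1 / 2 + t * I)))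
          = ∑ k ∈ Finset.range (b ^ J), A k * ((k : ℂ) + 1) ^ (-(1 / 2 + t * I)) :=
            Fin.sum_univ_eq_sum_range (fun k => A k * ((k : ℂ) + 1) ^ (-(1 / 2 + t * I))) (b ^ J)
        _ = ∑ k ∈ Finset.range (b ^ J), ∑ j ∈ Finset.range J,
              (if k + 1 = b ^ j then c j else 0) * ((k : ℂ) + 1) ^ (-(1 / 2 + t * I)) := by
            simp only [hA, Finset.sum_mul]
        _ = ∑ j ∈ Finset.range J, ∑ k ∈ Finset.range (b ^ J),
              (if k + 1 = b ^ j then c j else 0) * ((k : ℂ) + 1) ^ (-(1 / 2 + t * I)) :=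
            Finset.sum_comm
        _ = ∑ j ∈ Finset.range J, c j * ((b ^ j : ℕ) : ℂ) ^ (-(1 / 2 + t * I)) :=
            Finset.sum_congr rfl key
        _ = ∑ j ∈ Finset.range J, p.coeff j * Complex.exp (((-(Real.log b * t)) : ℝ) * I) ^ j := by
            refine Finset.sum_congr rfl fun j _ => ?_
            rw [hc]
            dsimp only
            rw [mul_assoc, cpow_half_mul_cpow_neg_pow b j hb0 t]
        _ = p.eval (Complex.exp (((-(Real.log b * t)) : ℝ) * I)) :=
            (Polynomial.eval_eq_sum_range _).symm
    simp_rw [hD]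
    exact hmain _ fun t ht => (hp ⟨t, ht⟩).le

/-! ## §W.2 — the zeta instance: the low window is a theorem -/

/-- `t ↦ ζ(1/2+it)` is continuous. [folklore] -/
private theorem continuous_zeta_half : Continuous fun t : ℝ => riemannZeta (1 / 2 + t * I) := by
  refine continuous_iff_continuousAt.2 fun t => ?_
  have hne : (1 / 2 : ℂ) + t * I ≠ 1 := by
    intro h
    have := congrArg Complex.re h
    norm_num at this
  have hc : Continuous fun τ : ℝ => (1 / 2 : ℂ) + τ * I := by fun_prop
  change ContinuousAt (riemannZeta ∘ fun τ : ℝ => (1 / 2 : ℂ) + τ * I) t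
  exact ContinuousAt.comp (differentiableAt_riemannZeta hne).continuousAt hc.continuousAt

/-- nb/neg V41 (LOW WINDOW, kernel, RH-free): for every base `b ≥ 2` and every height `T ≥ 0` with
`T·log b < π/2`, the Báez-Duarte distance RESTRICTED TO `|t| ≤ T` tends to `0` along Dirichlet polynomials
supported on the powers of `b` alone:
`∀ ε > 0, ∃ N a, (a_n ≠ 0 → n+1 = b^j) ∧ ∫⁻_{[-T,T]} |1 - ζ(1/2+it)·Σ a_n (n+1)^{-(1/2+it)}|²/(1/4+t²) < ε`.
No zero of `ζ`, no numerics and no RH enter (`window_dirichlet` with `ae_riemannZeta_half_ne_zero`).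
[folklore] -/
theorem nbWindow_Icc {b : ℕ} (hb : 2 ≤ b) {T : ℝ} (hT : 0 ≤ T) (hbT : T * Real.log b < π / 2) :
    ∀ ε : ℝ, 0 < ε → ∃ (N : ℕ) (a : Fin N → ℂ), (∀ n : Fin N, a n ≠ 0 → ∃ j : ℕ, (n : ℕ) + 1 = b ^ j) ∧
      ∫⁻ t in Set.Icc (-T) T, ENNReal.ofReal (‖1 - riemannZeta (1 / 2 + t * Complex.I) *
        ∑ n : Fin N, a n * ((n : ℂ) + 1) ^ (-(1 / 2 + t * Complex.I))‖ ^ 2 / (1 / 4 + t ^ 2)) <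
        ENNReal.ofReal ε :=
  fun _ hε => window_dirichlet continuous_zeta_half ae_riemannZeta_half_ne_zero hb hT hbT hε

/-- The numerical side condition for `b = 2`, `T = 2`: `2 log 2 < π/2` (`log 2 < 0.6931471808`,
`π > 3.14`). [folklore] -/
theorem two_mul_log_two_lt : (2 : ℝ) * Real.log (2 : ℕ) < π / 2 := by
  have h1 := Real.log_two_lt_d9
  have h2 := Real.pi_gt_d2
  push_cast
  linarith

/-- nb/neg V41, the instance `b = 2`, `T = 2`: the distance restricted to `|t| ≤ 2` tends to `0` along
Dirichlet polynomials supported on `{2^j}` — RH-free. [folklore] -/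
theorem nbWindow_Icc_two :
    ∀ ε : ℝ, 0 < ε → ∃ (N : ℕ) (a : Fin N → ℂ), (∀ n : Fin N, a n ≠ 0 → ∃ j : ℕ, (n : ℕ) + 1 = 2 ^ j) ∧
      ∫⁻ t in Set.Icc (-2 : ℝ) 2, ENNReal.ofReal (‖1 - riemannZeta (1 / 2 + t * Complex.I) *
        ∑ n : Fin N, a n * ((n : ℂ) + 1) ^ (-(1 / 2 + t * Complex.I))‖ ^ 2 / (1 / 4 + t ^ 2)) <
        ENNReal.ofReal ε :=
  nbWindow_Icc (b := 2) le_rfl (T := 2) (by norm_num) two_mul_log_two_lt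

/-- The plain low window (no support restriction): for `0 ≤ T` with `T·log 2 < π/2` (e.g. `T ≤ 2.26`),
`W([-T,T])` holds unconditionally. [folklore] -/
theorem nbWindow_Icc_plain {T : ℝ} (hT : 0 ≤ T) (hT2 : T * Real.log (2 : ℕ) < π / 2) :
    ∀ ε : ℝ, 0 < ε → ∃ (N : ℕ) (a : Fin N → ℂ),
      ∫⁻ t in Set.Icc (-T) T, ENNReal.ofReal (‖1 - riemannZeta (1 / 2 + t * Complex.I) *
        ∑ n : Fin N, a n * ((n : ℂ) + 1) ^ (-(1 / 2 + t * Complex.I))‖ ^ 2 / (1 / 4 + t ^ 2)) <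
        ENNReal.ofReal ε := by
  intro ε hε
  obtain ⟨N, a, -, h⟩ := nbWindow_Icc (b := 2) le_rfl hT hT2 ε hε
  exact ⟨N, a, h⟩

/-! ## §W.2d — contrast: on the FULL line the same support is locked out (kernel, zero-free) -/

/-- CONTRAST (kernel, RH-free, zero-free).  On the FULL line the family that suffices on the low window
is locked out: there is `ε > 0` such that EVERY Dirichlet polynomial supported on the powers of `2` has
Báez-Duarte distance `≥ ε`.  (Index `n = 2`, i.e. `n+1 = 3`, is not a power of `2`, so `a_2 = 0`,
while the budget-free Möbius lock `NbPlateauLock.nbMoebiusLockFree` forces `‖a_2 - μ(3)‖ ≤ 1/2` once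
the distance is small; lengths `N ≤ 2` are covered by the sparsity floor `NbSparsity.nbSparse_floor 2`.)
[folklore] -/
theorem nb_fullLine_powersOfTwo_floor :
    ∃ ε : ℝ, 0 < ε ∧ ∀ (N : ℕ) (a : Fin N → ℂ), (∀ n : Fin N, a n ≠ 0 → ∃ j : ℕ, (n : ℕ) + 1 = 2 ^ j) →
      ENNReal.ofReal ε ≤ ∫⁻ t : ℝ, ENNReal.ofReal (‖1 - riemannZeta (1 / 2 + t * Complex.I) *
        ∑ n : Fin N, a n * ((n : ℂ) + 1) ^ (-(1 / 2 + t * Complex.I))‖ ^ 2 / (1 / 4 + t ^ 2)) := by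
  obtain ⟨ε₁, hε₁, h₁⟩ := NbPlateauLock.nbMoebiusLockFree 2 (1 / 2) (by norm_num)
  obtain ⟨ε₂, hε₂, h₂⟩ := NbSparsity.nbSparse_floor 2
  refine ⟨min ε₁ ε₂, lt_min hε₁ hε₂, fun N a hsupp => ?_⟩
  by_cases hN : 2 < N
  · by_contra hlt
    push Not at hlt
    have hI := h₁ N a hN (hlt.le.trans (ENNReal.ofReal_le_ofReal (min_le_left _ _)))
    have ha : a ⟨2, hN⟩ = 0 := by
      by_contra hne
      obtain ⟨j, hj⟩ := hsupp _ hne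
      have h3 : (3 : ℕ) = 2 ^ j := hj
      rcases Nat.lt_or_ge j 2 with hj2 | hj2
      · interval_cases j <;> simp at h3
      · have h4 : (4 : ℕ) ≤ 2 ^ j :=
          calc (4 : ℕ) = 2 ^ 2 := by norm_num
            _ ≤ 2 ^ j := Nat.pow_le_pow_right (by norm_num) hj2
        omega
    have hμ : ArithmeticFunction.moebius (2 + 1) = -1 :=
      ArithmeticFunction.moebius_apply_prime Nat.prime_three
    rw [ha, hμ] at hI
    norm_num at hI
  · push Not at hN
    refine (ENNReal.ofReal_le_ofReal (min_le_right _ _)).trans (h₂ N a ?_)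
    exact (Finset.card_le_univ _).trans (by simpa using hN)

/-- The two sides of V41 in one line: along Dirichlet polynomials supported on `{2^j}` the distance
restricted to `|t| ≤ 2` tends to `0` (`nbWindow_Icc_two`), while on the full line it stays `≥ ε₀ > 0`
(`nb_fullLine_powersOfTwo_floor`).  Both kernel facts are RH-free. [folklore] -/
theorem nbWindow_two_vs_fullLine :
    (∀ ε : ℝ, 0 < ε → ∃ (N : ℕ) (a : Fin N → ℂ), (∀ n : Fin N, a n ≠ 0 → ∃ j : ℕ, (n : ℕ) + 1 = 2 ^ j) ∧
      ∫⁻ t in Set.Icc (-2 : ℝ) 2, ENNReal.ofReal (‖1 - riemannZeta (1 / 2 + t * Complex.I) *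
        ∑ n : Fin N, a n * ((n : ℂ) + 1) ^ (-(1 / 2 + t * Complex.I))‖ ^ 2 / (1 / 4 + t ^ 2)) <
        ENNReal.ofReal ε) ∧
    (∃ ε : ℝ, 0 < ε ∧ ∀ (N : ℕ) (a : Fin N → ℂ), (∀ n : Fin N, a n ≠ 0 → ∃ j : ℕ, (n : ℕ) + 1 = 2 ^ j) →
      ENNReal.ofReal ε ≤ ∫⁻ t : ℝ, ENNReal.ofReal (‖1 - riemannZeta (1 / 2 + t * Complex.I) *
        ∑ n : Fin N, a n * ((n : ℂ) + 1) ^ (-(1 / 2 + t * Complex.I))‖ ^ 2 / (1 / 4 + t ^ 2))) :=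
  ⟨nbWindow_Icc_two, nb_fullLine_powersOfTwo_floor⟩

/-! ## §W.1 — bookkeeping: the full window is the thesis; monotonicity; RH gives every window -/

/-- The full window `E = univ` is literally `NbThesis`. [cite: BaezDuarte2003, Thm. 1.1] -/
theorem nbWindow_univ_iff :
    (∀ ε : ℝ, 0 < ε → ∃ (N : ℕ) (a : Fin N → ℂ),
      ∫⁻ t in (Set.univ : Set ℝ), ENNReal.ofReal (‖1 - riemannZeta (1 / 2 + t * Complex.I) *
        ∑ n : Fin N, a n * ((n : ℂ) + 1) ^ (-(1 / 2 + t * Complex.I))‖ ^ 2 / (1 / 4 + t ^ 2)) <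
        ENNReal.ofReal ε) ↔ NbThesis := by
  simp only [Measure.restrict_univ]
  rfl

/-- The full window is RH (Báez-Duarte). [cite: BaezDuarte2003, Thm. 1.1] -/
theorem nbWindow_univ_iff_rh :
    (∀ ε : ℝ, 0 < ε → ∃ (N : ℕ) (a : Fin N → ℂ),
      ∫⁻ t in (Set.univ : Set ℝ), ENNReal.ofReal (‖1 - riemannZeta (1 / 2 + t * Complex.I) *
        ∑ n : Fin N, a n * ((n : ℂ) + 1) ^ (-(1 / 2 + t * Complex.I))‖ ^ 2 / (1 / 4 + t ^ 2)) <
        ENNReal.ofReal ε) ↔ _root_.RiemannHypothesis :=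
  nbWindow_univ_iff.trans nbThesis_iff_riemannHypothesis

/-- The windowed distance is antitone in the window: `E ⊆ E'` and `W(E')` give `W(E)`. [folklore] -/
theorem nbWindow_mono {E E' : Set ℝ} (hEE' : E ⊆ E')
    (hW : ∀ ε : ℝ, 0 < ε → ∃ (N : ℕ) (a : Fin N → ℂ),
      ∫⁻ t in E', ENNReal.ofReal (‖1 - riemannZeta (1 / 2 + t * Complex.I) *
        ∑ n : Fin N, a n * ((n : ℂ) + 1) ^ (-(1 / 2 + t * Complex.I))‖ ^ 2 / (1 / 4 + t ^ 2)) <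
        ENNReal.ofReal ε) :
    ∀ ε : ℝ, 0 < ε → ∃ (N : ℕ) (a : Fin N → ℂ),
      ∫⁻ t in E, ENNReal.ofReal (‖1 - riemannZeta (1 / 2 + t * Complex.I) *
        ∑ n : Fin N, a n * ((n : ℂ) + 1) ^ (-(1 / 2 + t * Complex.I))‖ ^ 2 / (1 / 4 + t ^ 2)) <
        ENNReal.ofReal ε := by
  intro ε hε
  obtain ⟨N, a, h⟩ := hW ε hε
  exact ⟨N, a, (lintegral_mono_set hEE').trans_lt h⟩

/-- RH gives every window (deep half of Báez-Duarte + monotonicity). [cite: BaezDuarte2003, Thm. 1.1] -/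
theorem nbWindow_of_rh (E : Set ℝ) (hRH : _root_.RiemannHypothesis) :
    ∀ ε : ℝ, 0 < ε → ∃ (N : ℕ) (a : Fin N → ℂ),
      ∫⁻ t in E, ENNReal.ofReal (‖1 - riemannZeta (1 / 2 + t * Complex.I) *
        ∑ n : Fin N, a n * ((n : ℂ) + 1) ^ (-(1 / 2 + t * Complex.I))‖ ^ 2 / (1 / 4 + t ^ 2)) <
        ENNReal.ofReal ε :=
  nbWindow_mono (Set.subset_univ E) (nbWindow_univ_iff_rh.2 hRH)

/-! ## §W.3 — polarisation of height splittings -/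

/-- Logic of a splitting with a proved conjunct and an RH-implied complement: if `A` holds and `RH → B`,
then `(A ∧ B → RH) ↔ (B ↔ RH)`. [folklore] -/
theorem split_iff_of_left_of_rh_imp {A B : Prop} (hA : A) (hB : _root_.RiemannHypothesis → B) :
    (A ∧ B → _root_.RiemannHypothesis) ↔ (B ↔ _root_.RiemannHypothesis) :=
  ⟨fun h => ⟨fun hb => h ⟨hA, hb⟩, hB⟩, fun h hab => h.1 hab.2⟩

/-- nb/neg V41 (POLARISATION of height splittings): for `0 ≤ T`, `T·log 2 < π/2` and ANY conjunct `B`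
implied by RH, the scheme `W([-T,T]) ∧ B ⟹ RH` holds iff `B ↔ RH` — the low window is decoration.
[folklore] -/
theorem nbWindow_split_iff {T : ℝ} (hT : 0 ≤ T) (hT2 : T * Real.log (2 : ℕ) < π / 2) (B : Prop)
    (hB : _root_.RiemannHypothesis → B) :
    (((∀ ε : ℝ, 0 < ε → ∃ (N : ℕ) (a : Fin N → ℂ),
      ∫⁻ t in Set.Icc (-T) T, ENNReal.ofReal (‖1 - riemannZeta (1 / 2 + t * Complex.I) *
        ∑ n : Fin N, a n * ((n : ℂ) + 1) ^ (-(1 / 2 + t * Complex.I))‖ ^ 2 / (1 / 4 + t ^ 2)) <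
        ENNReal.ofReal ε) ∧ B) → _root_.RiemannHypothesis) ↔ (B ↔ _root_.RiemannHypothesis) :=
  split_iff_of_left_of_rh_imp (nbWindow_Icc_plain hT hT2) hB

/-- nb/neg V41, the complementary-window instance: `W([-T,T]) ∧ W(ℝ ∖ [-T,T]) ⟹ RH` holds iff
`W(ℝ ∖ [-T,T]) ↔ RH` (for `0 ≤ T`, `T log 2 < π/2`); i.e. the height split is a splitting of `E_NB` only if
its high conjunct is already summit-strength. [folklore] -/
theorem nbWindow_split_compl_iff {T : ℝ} (hT : 0 ≤ T) (hT2 : T * Real.log (2 : ℕ) < π / 2) :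
    (((∀ ε : ℝ, 0 < ε → ∃ (N : ℕ) (a : Fin N → ℂ),
      ∫⁻ t in Set.Icc (-T) T, ENNReal.ofReal (‖1 - riemannZeta (1 / 2 + t * Complex.I) *
        ∑ n : Fin N, a n * ((n : ℂ) + 1) ^ (-(1 / 2 + t * Complex.I))‖ ^ 2 / (1 / 4 + t ^ 2)) <
        ENNReal.ofReal ε) ∧
      (∀ ε : ℝ, 0 < ε → ∃ (N : ℕ) (a : Fin N → ℂ),
      ∫⁻ t in (Set.Icc (-T) T)ᶜ, ENNReal.ofReal (‖1 - riemannZeta (1 / 2 + t * Complex.I) *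
        ∑ n : Fin N, a n * ((n : ℂ) + 1) ^ (-(1 / 2 + t * Complex.I))‖ ^ 2 / (1 / 4 + t ^ 2)) <
        ENNReal.ofReal ε)) → _root_.RiemannHypothesis) ↔
    ((∀ ε : ℝ, 0 < ε → ∃ (N : ℕ) (a : Fin N → ℂ),
      ∫⁻ t in (Set.Icc (-T) T)ᶜ, ENNReal.ofReal (‖1 - riemannZeta (1 / 2 + t * Complex.I) *
        ∑ n : Fin N, a n * ((n : ℂ) + 1) ^ (-(1 / 2 + t * Complex.I))‖ ^ 2 / (1 / 4 + t ^ 2)) <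
        ENNReal.ofReal ε) ↔ _root_.RiemannHypothesis) :=
  nbWindow_split_iff hT hT2 _ (nbWindow_of_rh _)

end Summit.RiemannHypothesis.RiemannHypothesis.Theorems.Splittings.NbWindows

end
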